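import Summits.CriticalPhenomena.PercolationContinuityZ3.Theorems.PercNearOneGluingNoHeavyLowerTailAntitheticTwinPairClusters
import Summits.CriticalPhenomena.PercolationContinuityZ3.Theorems.PercNearOneGluingNoHeavyLowerTailAntitheticAbstractUpset
import Summits.CriticalPhenomena.PercolationContinuityZ3.Theorems.PercNearOneGluingNoHeavyLowerTailAntitheticTopCommon
import HarnessLib

/-!
# `NoHeavyLowerTail` (stmt-CriticalPhenomena-4575) — antithetic cluster pairs: **THEOREM TP (pairing principle, smallest case): the top event
# at a twin `P` of the source over a NON-EDGE `{a, j}`, `j` of degree 3 — where every single type pattern can be NEGATIVE**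
# (prim-hp-2 gen 73, HOME/THEOREM-TW.md §3ter)

Support file (`--supports stmt-CriticalPhenomena-4575`, hull-port prover `prim-hp-2`, gen 73).  No definitions, no named facts, no sorries;
standard axioms.  Setting of …AntitheticTwinPairClusters: `N(s) = N(P) = {a, j}`, `a ≠ j`, `N(j) = {s, P, j₀}`; `E'` = pairs of `E` avoiding
`s, P, j`.  THEOREM TP (`TwinPair.top_shift_sum_nonneg`, `TwinPair.vertex_sum_nonneg`): TOP_shift(E; P) ≥ 0 and the |R| = 1 VERTEX
ANTITHETIC INEQUALITY at `P` — with NO hypothesis on the rest of the graph (`G − s − P − j` arbitrary, `j₀` anywhere in it).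
PROOF.  TOP = (some common neighbour red–red: `Twin.top_rr_sum_nonneg`) ⊔ pattern 1 ⊔ pattern 2 (…TwinPairClusters; the (RB,RB)/(BR,BR)
patterns are empty).  With `X₀ T = {s,P,j} ∪ openCluster (T ∩ E') a`, `Y₀ T = {s} ∪ openCluster (Tᶜ ∩ E') a`, `𝒰 = {j₀ ∈ openCluster (T ∩ E') a}`:
pattern 1 contributes `Σ_{𝒰 ∩ pattern 1} Φ(X₀, {s, j})`, pattern 2 contributes `Σ_{𝒰 ∩ pattern 2} Φ(X₀, Y₀)`.  The five pattern pairs are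
invisible to `X₀, Y₀, 𝒰`, so both are block averages of sums over ALL colourings (`TopCommon.fubini_branch_nonneg`; the patterns are exchanged by
`T ↦ T ∆ {sa, Pa, sj, Pj}`), and `Φ(X₀, {s, j}) ≥ (F⁺X₀ − F⁺A₀)(G⁺X₀ − G⁺A₀)` with `A₀ = {s, P, j, a} ⊆ X₀`.  THEOREM U in abstract form
(`Upset.abstract_upset_diag_sum_nonneg`: `X₀` increasing, `Y₀` decreasing, `Y₀(Tᶜ) ⊆ X₀(T)`, `𝒰` increasing) gives
`Σ_𝒰 [Φ(X₀, Y₀) + (F⁺X₀ − F⁺A₀)(G⁺X₀ − G⁺A₀)] ≥ 0`: the nested pattern 1 PAYS for the diagonal of pattern 2, although pattern 2 alone is the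
⊕-sum of `(G − s − P − j, a, j₀)` and can be negative (fan₆: −46; HOME/THEOREM-TW.md §3).
[cite: VandenbergHaggstromKahn2005, §1 p. 6 ("Harris' inequality"), §1 p. 3 (open cluster `C_s`)]
-/

noncomputable section

namespace Summit.CriticalPhenomena.PercolationContinuityZ3.Theorems

open Literature.Probability.Percolation
open scoped Classical symmDiff

namespace Antithetic

namespace TwinPair

variable {V : Type*}

/-- Symmetric difference with a set of pairs missing `K` does not change `· ∩ K`. [folklore] -/
theorem symmDiff_inter_eq {K D T : Set (Sym2 V)} (hD : ∀ e ∈ D, e ∉ K) : (T ∆ D) ∩ K = T ∩ K := by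
  ext e
  simp only [Set.mem_inter_iff, Set.mem_symmDiff]
  constructor
  · rintro ⟨h | h, hK⟩
    · exact ⟨h.1, hK⟩
    · exact absurd hK (hD e h.1)
  · rintro ⟨hT, hK⟩
    exact ⟨Or.inl ⟨hT, fun h => hD e h hK⟩, hK⟩

/-- Membership in `T ∆ D` for a pair of `D`. [folklore] -/
theorem mem_symmDiff_iff_of_mem {D T : Set (Sym2 V)} {e : Sym2 V} (he : e ∈ D) : e ∈ T ∆ D ↔ e ∉ T := by
  rw [Set.mem_symmDiff]
  exact ⟨fun h => h.elim (fun h' => absurd he h'.2) fun h' => h'.2, fun h => Or.inr ⟨he, h⟩⟩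

/-- Membership in `T ∆ D` for a pair outside `D`. [folklore] -/
theorem mem_symmDiff_iff_of_not_mem {D T : Set (Sym2 V)} {e : Sym2 V} (he : e ∉ D) : e ∈ T ∆ D ↔ e ∈ T := by
  rw [Set.mem_symmDiff]
  exact ⟨fun h => h.elim (fun h' => h'.1) fun h' => absurd h'.1 he, fun h => Or.inl ⟨h, he⟩⟩

variable [Fintype V]

/-- **THEOREM TP (twins over a non-edge `{a, j}` with `N(j) = {s, P, j₀}`; top form, shifted class).**  For every finite `E` with
`N(s) = N(P) = {a, j}`, `a ≠ j`, `N(j) = {s, P, j₀}` (`s, P, a, j, j₀` distinct as stated) and all monotone `F⁻ ≤ F⁺`, `G⁻ ≤ G⁺`: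
`0 ≤ Σ_{T : P ∈ X T, P ∉ Y T} (F⁺(X T) − F⁻(Y T))·(G⁺(X T) − G⁻(Y T))`. [this work] -/
theorem top_shift_sum_nonneg (E : Set (Sym2 V)) (s P a j j₀ : V)
    (hsP : s ≠ P) (hsa : s ≠ a) (hsj : s ≠ j) (hPa : P ≠ a) (hPj : P ≠ j) (haj : a ≠ j) (hj₀s : j₀ ≠ s) (hj₀P : j₀ ≠ P) (hj₀j : j₀ ≠ j)
    (hNs : ∀ v, s(s, v) ∈ E ↔ (v = a ∨ v = j)) (hNP : ∀ v, s(P, v) ∈ E ↔ (v = a ∨ v = j))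
    (hNj : ∀ v, s(j, v) ∈ E ↔ (v = s ∨ v = P ∨ v = j₀))
    (Fp Fm Gp Gm : Set V → ℝ) (hFp : Monotone Fp) (hFm : Monotone Fm) (hF : ∀ S, Fm S ≤ Fp S)
    (hGp : Monotone Gp) (hGm : Monotone Gm) (hG : ∀ S, Gm S ≤ Gp S) :
    0 ≤ ∑ T ∈ Finset.univ.filter (fun T : Set (Sym2 V) => P ∈ openCluster (T ∩ E) s ∧ P ∉ openCluster (Tᶜ ∩ E) s),
      (Fp (openCluster (T ∩ E) s) - Fm (openCluster (Tᶜ ∩ E) s)) * (Gp (openCluster (T ∩ E) s) - Gm (openCluster (Tᶜ ∩ E) s)) := by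
  -- the graph `H − j`
  set E' : Set (Sym2 V) := {e | e ∈ E ∧ s ∉ e ∧ P ∉ e ∧ j ∉ e} with hE'
  -- abstract clusters, event and anchor
  let X₀ : Set (Sym2 V) → Set V := fun T => insert s (insert P (insert j (openCluster (T ∩ E') a)))
  let Y₀ : Set (Sym2 V) → Set V := fun T => insert s (openCluster (Tᶜ ∩ E') a)
  let U : Set (Sym2 V) → Prop := fun T => j₀ ∈ openCluster (T ∩ E') a
  let A₀ : Set V := insert s (insert P (insert j {a}))
  let Φ : Set V → Set V → ℝ := fun A B => (Fp A - Fm B) * (Gp A - Gm B)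
  let DIAG : Set (Sym2 V) → ℝ := fun T => (Fp (X₀ T) - Fp A₀) * (Gp (X₀ T) - Gp A₀)
  have hA₀X : ∀ T, A₀ ⊆ X₀ T := by
    intro T u hu
    rcases hu with rfl | rfl | rfl | hu
    · exact Or.inl rfl
    · exact Or.inr (Or.inl rfl)
    · exact Or.inr (Or.inr (Or.inl rfl))
    · rw [Set.mem_singleton_iff] at hu; subst hu
      exact Or.inr (Or.inr (Or.inr (mem_openCluster_self _ _)))
  -- (1) THEOREM U in abstract form on `X₀, Y₀, 𝒰`
  have habs : 0 ≤ ∑ T ∈ Finset.univ.filter U, (Φ (X₀ T) (Y₀ T) + DIAG T) := by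
    refine Upset.abstract_upset_diag_sum_nonneg X₀ Y₀ (fun T T' h => ?_) (fun T T' h => ?_) (fun T => ?_) A₀ hA₀X U
      (fun T T' h hT => Freeze.openCluster_mono (Set.inter_subset_inter_left E' h) a hT) Fp Fm Gp Gm hFp hFm hF hGp hGm hG
    · exact Set.insert_subset_insert (Set.insert_subset_insert (Set.insert_subset_insert
        (Freeze.openCluster_mono (Set.inter_subset_inter_left E' h) a)))
    · exact Set.insert_subset_insert (Freeze.openCluster_mono (Set.inter_subset_inter_left E' (Set.compl_subset_compl.2 h)) a)
    · show insert s (openCluster (Tᶜᶜ ∩ E') a) ⊆ insert s (insert P (insert j (openCluster (T ∩ E') a)))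
      rw [compl_compl]
      exact Set.insert_subset_insert fun u hu => Or.inr (Or.inr hu)
  -- (2) the red–red part (…AntitheticTwinTop)
  have htwin : ∀ v, v ≠ s → v ≠ P → (s(s, v) ∈ E ↔ s(P, v) ∈ E) := fun v _ _ => (hNs v).trans (hNP v).symm
  have hK₁ : ∀ ⦃A A' B B' : Set V⦄, A ⊆ A' → B' ⊆ B → Fp A - Fm B ≤ Fp A' - Fm B' :=
    fun A A' B B' hA hB => sub_le_sub (hFp hA) (hFm hB)
  have hK₂ : ∀ ⦃A A' B B' : Set V⦄, A ⊆ A' → B' ⊆ B → Gp A - Gm B ≤ Gp A' - Gm B' :=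
    fun A A' B B' hA hB => sub_le_sub (hGp hA) (hGm hB)
  have hso₁ : ∀ A B : Set V, 0 ≤ (Fp A - Fm B) + (Fp B - Fm A) := fun A B => by linarith [hF A, hF B]
  have hso₂ : ∀ A B : Set V, 0 ≤ (Gp A - Gm B) + (Gp B - Gm A) := fun A B => by linarith [hG A, hG B]
  have hrr := Twin.top_rr_sum_nonneg E s P htwin (K₁ := fun A B => Fp A - Fm B) (K₂ := fun A B => Gp A - Gm B) hK₁ hso₁ hK₂ hso₂
  rw [Finset.sum_filter] at hrr
  -- (3) pointwise decomposition of the top sum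
  let tops : Set (Sym2 V) → Prop := fun T => P ∈ openCluster (T ∩ E) s ∧ P ∉ openCluster (Tᶜ ∩ E) s
  let p₁ : Set (Sym2 V) → Prop := fun T => s(s, a) ∈ T ∧ s(P, a) ∉ T ∧ s(s, j) ∉ T ∧ s(P, j) ∈ T ∧ s(j, j₀) ∈ T ∧ U T
  let p₂ : Set (Sym2 V) → Prop := fun T => s(s, a) ∉ T ∧ s(P, a) ∈ T ∧ s(s, j) ∈ T ∧ s(P, j) ∉ T ∧ s(j, j₀) ∈ T ∧ U T
  let ΦG : Set (Sym2 V) → ℝ := fun T => (Fp (openCluster (T ∩ E) s) - Fm (openCluster (Tᶜ ∩ E) s)) *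
    (Gp (openCluster (T ∩ E) s) - Gm (openCluster (Tᶜ ∩ E) s))
  have key : ∀ T : Set (Sym2 V), (if tops T then ΦG T else 0) =
      (if P ∈ openCluster (T ∩ E) s ∧ P ∉ openCluster (Tᶜ ∩ E) s ∧
          ∃ v, v ≠ s ∧ v ≠ P ∧ s(s, v) ∈ E ∧ s(s, v) ∈ T ∧ s(P, v) ∈ T then ΦG T else 0) +
      (if p₁ T then Φ (X₀ T) (insert s ({j} : Set V)) else 0) + (if p₂ T then Φ (X₀ T) (Y₀ T) else 0) := by
    intro T
    by_cases h1 : p₁ T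
    · -- pattern 1
      obtain ⟨hsa', hPa', hsj', hPj', hjj, hU⟩ := h1
      have hX := red_eq₁ hE' hsa hPa hPj haj hj₀j hNs hNP hNj hsa' hPj' hjj hU
      have hY := blue_eq₁ hsj hNs hNj hsa' hsj' hPj' hjj
      have htop : tops T := by
        refine ⟨?_, ?_⟩
        · show P ∈ openCluster (T ∩ E) s; rw [hX]; exact Or.inr (Or.inl rfl)
        · show P ∉ openCluster (Tᶜ ∩ E) s; rw [hY]
          rintro (h | h)
          · exact hsP h.symm
          · exact hPj (Set.mem_singleton_iff.1 h)
      have hnoRR : ¬ (P ∈ openCluster (T ∩ E) s ∧ P ∉ openCluster (Tᶜ ∩ E) s ∧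
          ∃ v, v ≠ s ∧ v ≠ P ∧ s(s, v) ∈ E ∧ s(s, v) ∈ T ∧ s(P, v) ∈ T) := by
        rintro ⟨-, -, v, -, -, hvE, hsv, hPv⟩
        rcases (hNs v).1 hvE with rfl | rfl
        · exact hPa' hPv
        · exact hsj' hsv
      have hn2 : ¬ p₂ T := fun h => h.1 hsa'
      rw [if_pos htop, if_neg hnoRR, if_pos ⟨hsa', hPa', hsj', hPj', hjj, hU⟩, if_neg hn2, zero_add, add_zero]
      show (Fp (openCluster (T ∩ E) s) - Fm (openCluster (Tᶜ ∩ E) s)) * (Gp (openCluster (T ∩ E) s) - Gm (openCluster (Tᶜ ∩ E) s)) =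
        (Fp (X₀ T) - Fm (insert s ({j} : Set V))) * (Gp (X₀ T) - Gm (insert s ({j} : Set V)))
      rw [hX, hY]
    by_cases h2 : p₂ T
    · -- pattern 2
      obtain ⟨hsa', hPa', hsj', hPj', hjj, hU⟩ := h2
      have hX := red_eq₂ hE' hsa hsj hPa haj hj₀j hNs hNP hNj hsa' hPa' hsj' hjj hU
      have hY := blue_eq₂ hE' hsa hPa haj hNs hNP hNj hsa' hPa' hsj' hjj
      have htop : tops T := by
        refine ⟨?_, ?_⟩
        · show P ∈ openCluster (T ∩ E) s; rw [hX]; exact Or.inr (Or.inl rfl)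
        · show P ∉ openCluster (Tᶜ ∩ E) s; rw [hY]
          rintro (h | h)
          · exact hsP h.symm
          · exact (cluster_E'_avoids hE' hsa.symm hPa.symm haj h).2.1 rfl
      have hnoRR : ¬ (P ∈ openCluster (T ∩ E) s ∧ P ∉ openCluster (Tᶜ ∩ E) s ∧
          ∃ v, v ≠ s ∧ v ≠ P ∧ s(s, v) ∈ E ∧ s(s, v) ∈ T ∧ s(P, v) ∈ T) := by
        rintro ⟨-, -, v, -, -, hvE, hsv, hPv⟩
        rcases (hNs v).1 hvE with rfl | rfl
        · exact hsa' hsv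
        · exact hPj' hPv
      rw [if_pos htop, if_neg hnoRR, if_neg h1, if_pos ⟨hsa', hPa', hsj', hPj', hjj, hU⟩, zero_add, zero_add]
      show (Fp (openCluster (T ∩ E) s) - Fm (openCluster (Tᶜ ∩ E) s)) * (Gp (openCluster (T ∩ E) s) - Gm (openCluster (Tᶜ ∩ E) s)) =
        (Fp (X₀ T) - Fm (Y₀ T)) * (Gp (X₀ T) - Gm (Y₀ T))
      rw [hX, hY]
    -- neither pattern: the top event forces a red–red common neighbour
    rw [if_neg h1, if_neg h2, add_zero, add_zero]
    by_cases htop : tops T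
    · have hRR : ∃ v, v ≠ s ∧ v ≠ P ∧ s(s, v) ∈ E ∧ s(s, v) ∈ T ∧ s(P, v) ∈ T := by
        by_contra hno
        have na := Twin.noBB_of_top htwin htop.2 hsa.symm hPa.symm ((hNs a).2 (Or.inl rfl))
        have nj := Twin.noBB_of_top htwin htop.2 hsj.symm hPj.symm ((hNs j).2 (Or.inr rfl))
        have ra : ¬ (s(s, a) ∈ T ∧ s(P, a) ∈ T) := fun h => hno ⟨a, hsa.symm, hPa.symm, (hNs a).2 (Or.inl rfl), h.1, h.2⟩
        have rj : ¬ (s(s, j) ∈ T ∧ s(P, j) ∈ T) := fun h => hno ⟨j, hsj.symm, hPj.symm, (hNs j).2 (Or.inr rfl), h.1, h.2⟩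
        -- four cases for the types of `a` and `j`
        rcases na with ha | ha <;> rcases nj with hj | hj
        · exact not_top_RB_RB hNP (fun h => ra ⟨ha, h⟩) (fun h => rj ⟨hj, h⟩) hsP htop.1
        · -- a: sa red (so Pa blue), j: Pj red (so sj blue): pattern 1 up to the link
          have hPa' : s(P, a) ∉ T := fun h => ra ⟨ha, h⟩
          have hsj' : s(s, j) ∉ T := fun h => rj ⟨h, hj⟩
          obtain ⟨hjj, hU⟩ := link_of_top₁ hE' hsP hsa hPa haj hNs hNP hNj hPa' hsj' htop.1
          exact h1 ⟨ha, hPa', hsj', hj, hjj, hU⟩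
        · have hsa' : s(s, a) ∉ T := fun h => ra ⟨h, ha⟩
          have hPj' : s(P, j) ∉ T := fun h => rj ⟨hj, h⟩
          obtain ⟨hjj, hU⟩ := link_of_top₂ hE' hsP hPa hPj haj hj₀s hj₀P hj₀j hNs hNP hNj hsa' hPj' htop.1
          exact h2 ⟨hsa', ha, hj, hPj', hjj, hU⟩
        · exact not_top_BR_BR hNs (fun h => ra ⟨h, ha⟩) (fun h => rj ⟨h, hj⟩) hsP htop.1
      rw [if_pos htop, if_pos ⟨htop.1, htop.2, hRR⟩]
    · have hnoRR : ¬ (P ∈ openCluster (T ∩ E) s ∧ P ∉ openCluster (Tᶜ ∩ E) s ∧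
          ∃ v, v ≠ s ∧ v ≠ P ∧ s(s, v) ∈ E ∧ s(s, v) ∈ T ∧ s(P, v) ∈ T) := fun h => htop ⟨h.1, h.2.1⟩
      rw [if_neg htop, if_neg hnoRR]
  -- (4) the pattern-1 terms dominate the diagonal
  have hdiag : ∀ T, (if p₁ T then DIAG T else 0) ≤ (if p₁ T then Φ (X₀ T) (insert s ({j} : Set V)) else 0) := by
    intro T
    split_ifs with h
    · have hsj_sub : insert s ({j} : Set V) ⊆ A₀ := by
        rintro u (rfl | hu)
        · exact Or.inl rfl
        · rw [Set.mem_singleton_iff] at hu; subst hu; exact Or.inr (Or.inr (Or.inl rfl))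
      have h1 : Fm (insert s ({j} : Set V)) ≤ Fp A₀ := (hF _).trans (hFp hsj_sub)
      have h2 : Gm (insert s ({j} : Set V)) ≤ Gp A₀ := (hG _).trans (hGp hsj_sub)
      have h3 : Fp A₀ ≤ Fp (X₀ T) := hFp (hA₀X T)
      have h4 : Gp A₀ ≤ Gp (X₀ T) := hGp (hA₀X T)
      exact mul_le_mul (sub_le_sub_left h1 _) (sub_le_sub_left h2 _) (sub_nonneg.2 h4) (sub_nonneg.2 (h1.trans h3))
    · exact le_rfl
  -- (5) the two patterns are exchanged by `T ↦ T ∆ D`, `D = {sa, Pa, sj, Pj}`, which `X₀`, `𝒰`, `DIAG` do not see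
  let D : Set (Sym2 V) := insert s(s, a) (insert s(P, a) (insert s(s, j) {s(P, j)}))
  have hDE' : ∀ e ∈ D, e ∉ E' := by
    intro e he heE'
    have h' : s ∉ e ∧ P ∉ e := by rw [hE'] at heE'; exact ⟨heE'.2.1, heE'.2.2.1⟩
    rcases he with rfl | rfl | rfl | he
    · exact h'.1 (Sym2.mem_mk_left _ _)
    · exact h'.2 (Sym2.mem_mk_left _ _)
    · exact h'.1 (Sym2.mem_mk_left _ _)
    · rw [Set.mem_singleton_iff] at he; subst he; exact h'.2 (Sym2.mem_mk_left _ _)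
  have hjjD : s(j, j₀) ∉ D := by
    rintro (h | h | h | h)
    · rcases Sym2.eq_iff.1 h with ⟨h1, -⟩ | ⟨-, h2⟩
      · exact hsj h1.symm
      · exact hj₀s h2
    · rcases Sym2.eq_iff.1 h with ⟨h1, -⟩ | ⟨-, h2⟩
      · exact hPj h1.symm
      · exact hj₀P h2
    · rcases Sym2.eq_iff.1 h with ⟨h1, -⟩ | ⟨-, h2⟩
      · exact hsj h1.symm
      · exact hj₀s h2
    · rw [Set.mem_singleton_iff] at h
      rcases Sym2.eq_iff.1 h with ⟨h1, -⟩ | ⟨-, h2⟩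
      · exact hPj h1.symm
      · exact hj₀P h2
  have hX₀D : ∀ T, X₀ (T ∆ D) = X₀ T := fun T => by
    show insert s (insert P (insert j (openCluster ((T ∆ D) ∩ E') a))) = _
    rw [symmDiff_inter_eq hDE']
  have hUD : ∀ T, U (T ∆ D) ↔ U T := fun T => by
    show j₀ ∈ openCluster ((T ∆ D) ∩ E') a ↔ _
    rw [symmDiff_inter_eq hDE']
  have hswap : ∑ T : Set (Sym2 V), (if p₁ T then DIAG T else 0) = ∑ T : Set (Sym2 V), (if p₂ T then DIAG T else 0) := by
    refine Fintype.sum_equiv (Function.Involutive.toPerm (fun T : Set (Sym2 V) => T ∆ D) fun T => symmDiff_symmDiff_cancel_right D T)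
      _ _ fun T => ?_
    show (if p₁ T then DIAG T else 0) = (if p₂ (T ∆ D) then DIAG (T ∆ D) else 0)
    have e_sa : s(s, a) ∈ T ∆ D ↔ s(s, a) ∉ T := mem_symmDiff_iff_of_mem (Or.inl rfl)
    have e_Pa : s(P, a) ∈ T ∆ D ↔ s(P, a) ∉ T := mem_symmDiff_iff_of_mem (Or.inr (Or.inl rfl))
    have e_sj : s(s, j) ∈ T ∆ D ↔ s(s, j) ∉ T := mem_symmDiff_iff_of_mem (Or.inr (Or.inr (Or.inl rfl)))
    have e_Pj : s(P, j) ∈ T ∆ D ↔ s(P, j) ∉ T := mem_symmDiff_iff_of_mem (Or.inr (Or.inr (Or.inr rfl)))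
    have e_jj : s(j, j₀) ∈ T ∆ D ↔ s(j, j₀) ∈ T := mem_symmDiff_iff_of_not_mem hjjD
    have hiff : p₁ T ↔ p₂ (T ∆ D) := by
      show (s(s, a) ∈ T ∧ s(P, a) ∉ T ∧ s(s, j) ∉ T ∧ s(P, j) ∈ T ∧ s(j, j₀) ∈ T ∧ U T) ↔
        (s(s, a) ∉ T ∆ D ∧ s(P, a) ∈ T ∆ D ∧ s(s, j) ∈ T ∆ D ∧ s(P, j) ∉ T ∆ D ∧ s(j, j₀) ∈ T ∆ D ∧ U (T ∆ D))
      rw [e_sa, e_Pa, e_sj, e_Pj, e_jj, hUD, not_not, not_not]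
    by_cases h : p₁ T
    · rw [if_pos h, if_pos (hiff.1 h)]
      show (Fp (X₀ T) - Fp A₀) * (Gp (X₀ T) - Gp A₀) = (Fp (X₀ (T ∆ D)) - Fp A₀) * (Gp (X₀ (T ∆ D)) - Gp A₀)
      rw [hX₀D]
    · rw [if_neg h, if_neg (fun h' => h (hiff.2 h'))]
  -- (6) block average of the abstract U inequality on pattern 2 (`TopCommon.fubini_branch_nonneg`)
  let A : Set (Sym2 V) := insert s(j, j₀) D
  let π₂ : Set (Sym2 V) := insert s(P, a) (insert s(s, j) {s(j, j₀)})
  have hAE' : ∀ e ∈ A, e ∉ E' := by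
    rintro e (rfl | he)
    · intro h; rw [hE'] at h; exact h.2.2.2 (Sym2.mem_mk_left _ _)
    · exact hDE' e he
  -- distinctness of the pattern pairs needed below
  have ne_sa_Pa : s(s, a) ≠ s(P, a) := fun h => by
    rcases Sym2.eq_iff.1 h with ⟨h1, -⟩ | ⟨h1, _⟩
    · exact hsP h1
    · exact hsa h1
  have ne_sa_sj : s(s, a) ≠ s(s, j) := fun h => by
    rcases Sym2.eq_iff.1 h with ⟨-, h2⟩ | ⟨h1, -⟩
    · exact haj h2
    · exact hsj h1
  have ne_sa_jj : s(s, a) ≠ s(j, j₀) := fun h => by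
    rcases Sym2.eq_iff.1 h with ⟨h1, -⟩ | ⟨h1, _⟩
    · exact hsj h1
    · exact hj₀s h1.symm
  have ne_Pj_Pa : s(P, j) ≠ s(P, a) := fun h => by
    rcases Sym2.eq_iff.1 h with ⟨-, h2⟩ | ⟨h1, _⟩
    · exact haj h2.symm
    · exact hPa h1
  have ne_Pj_sj : s(P, j) ≠ s(s, j) := fun h => by
    rcases Sym2.eq_iff.1 h with ⟨h1, -⟩ | ⟨h1, _⟩
    · exact hsP h1.symm
    · exact hPj h1
  have ne_Pj_jj : s(P, j) ≠ s(j, j₀) := fun h => by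
    rcases Sym2.eq_iff.1 h with ⟨h1, -⟩ | ⟨h1, -⟩
    · exact hPj h1
    · exact hj₀P h1.symm
  have hpat : ∀ T : Set (Sym2 V), T ∩ A = π₂ ↔ (s(s, a) ∉ T ∧ s(P, a) ∈ T ∧ s(s, j) ∈ T ∧ s(P, j) ∉ T ∧ s(j, j₀) ∈ T) := by
    intro T
    have hA_sa : s(s, a) ∈ A := Or.inr (Or.inl rfl)
    have hA_Pa : s(P, a) ∈ A := Or.inr (Or.inr (Or.inl rfl))
    have hA_sj : s(s, j) ∈ A := Or.inr (Or.inr (Or.inr (Or.inl rfl)))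
    have hA_Pj : s(P, j) ∈ A := Or.inr (Or.inr (Or.inr (Or.inr rfl)))
    have hA_jj : s(j, j₀) ∈ A := Or.inl rfl
    have nπ_sa : s(s, a) ∉ π₂ := by
      rintro (h | h | h)
      · exact ne_sa_Pa h
      · exact ne_sa_sj h
      · exact ne_sa_jj (Set.mem_singleton_iff.1 h)
    have nπ_Pj : s(P, j) ∉ π₂ := by
      rintro (h | h | h)
      · exact ne_Pj_Pa h
      · exact ne_Pj_sj h
      · exact ne_Pj_jj (Set.mem_singleton_iff.1 h)
    constructor
    · intro h
      have m : ∀ e, e ∈ A → (e ∈ T ↔ e ∈ π₂) := fun e he =>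
        ⟨fun hT => (h ▸ (⟨hT, he⟩ : e ∈ T ∩ A)), fun hπ => ((h.symm ▸ hπ : e ∈ T ∩ A)).1⟩
      exact ⟨fun hT => nπ_sa ((m _ hA_sa).1 hT), (m _ hA_Pa).2 (Or.inl rfl), (m _ hA_sj).2 (Or.inr (Or.inl rfl)),
        fun hT => nπ_Pj ((m _ hA_Pj).1 hT), (m _ hA_jj).2 (Or.inr (Or.inr rfl))⟩
    · rintro ⟨h_sa, h_Pa, h_sj, h_Pj, h_jj⟩
      ext e
      constructor
      · rintro ⟨heT, heA⟩
        rcases heA with rfl | rfl | rfl | rfl | heA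
        · exact Or.inr (Or.inr rfl)
        · exact absurd heT h_sa
        · exact Or.inl rfl
        · exact Or.inr (Or.inl rfl)
        · rw [Set.mem_singleton_iff] at heA; subst heA; exact absurd heT h_Pj
      · rintro (rfl | rfl | he)
        · exact ⟨h_Pa, hA_Pa⟩
        · exact ⟨h_sj, hA_sj⟩
        · rw [Set.mem_singleton_iff] at he; subst he; exact ⟨h_jj, hA_jj⟩
  let g : Set (Sym2 V) → ℝ := fun T => if U T then Φ (X₀ T) (Y₀ T) + DIAG T else 0
  have hg_sum : 0 ≤ ∑ T : Set (Sym2 V), g T := by rw [Finset.sum_filter] at habs; exact habs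
  have hgA : ∀ T : Set (Sym2 V), g (T \ A) = g T := by
    intro T
    have h1 : (T \ A) ∩ E' = T ∩ E' := TopEar.inter_diff_eq hAE' T
    have h2 : (T \ A)ᶜ ∩ E' = Tᶜ ∩ E' := TopEar.compl_diff_inter_eq hAE' T
    show (if j₀ ∈ openCluster ((T \ A) ∩ E') a then
        Φ (insert s (insert P (insert j (openCluster ((T \ A) ∩ E') a)))) (insert s (openCluster ((T \ A)ᶜ ∩ E') a)) +
          (Fp (insert s (insert P (insert j (openCluster ((T \ A) ∩ E') a)))) - Fp A₀) *
            (Gp (insert s (insert P (insert j (openCluster ((T \ A) ∩ E') a)))) - Gp A₀) else 0) = _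
    rw [h1, h2]
  have hblock := TopCommon.fubini_branch_nonneg A π₂ g (fun T => if p₂ T then Φ (X₀ T) (Y₀ T) + DIAG T else 0) hg_sum hgA
    (fun T hT => by
      obtain ⟨h_sa, h_Pa, h_sj, h_Pj, h_jj⟩ := (hpat T).1 hT
      by_cases hU : U T
      · rw [if_pos (show p₂ T from ⟨h_sa, h_Pa, h_sj, h_Pj, h_jj, hU⟩)]; show _ = g T; simp only [g, if_pos hU]
      · rw [if_neg (fun h : p₂ T => hU h.2.2.2.2.2)]; show _ = g T; simp only [g, if_neg hU])
    (fun T hT => by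
      rw [if_neg]
      intro h
      exact hT ((hpat T).2 ⟨h.1, h.2.1, h.2.2.1, h.2.2.2.1, h.2.2.2.2.1⟩))
  -- (7) assemble
  rw [Finset.sum_filter]
  have hsplit : ∀ T : Set (Sym2 V), (if p₂ T then Φ (X₀ T) (Y₀ T) + DIAG T else 0) =
      (if p₂ T then Φ (X₀ T) (Y₀ T) else 0) + (if p₂ T then DIAG T else 0) := fun T => by
    split_ifs <;> ring
  simp_rw [hsplit] at hblock
  rw [Finset.sum_add_distrib] at hblock
  have h1 : ∑ T : Set (Sym2 V), (if tops T then ΦG T else 0) =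
      ∑ T : Set (Sym2 V), (if P ∈ openCluster (T ∩ E) s ∧ P ∉ openCluster (Tᶜ ∩ E) s ∧
          ∃ v, v ≠ s ∧ v ≠ P ∧ s(s, v) ∈ E ∧ s(s, v) ∈ T ∧ s(P, v) ∈ T then ΦG T else 0) +
      ∑ T : Set (Sym2 V), (if p₁ T then Φ (X₀ T) (insert s ({j} : Set V)) else 0) +
      ∑ T : Set (Sym2 V), (if p₂ T then Φ (X₀ T) (Y₀ T) else 0) := by
    rw [← Finset.sum_add_distrib, ← Finset.sum_add_distrib]
    exact Finset.sum_congr rfl fun T _ => key T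
  have h2 : ∑ T : Set (Sym2 V), (if p₁ T then DIAG T else 0) ≤ ∑ T : Set (Sym2 V), (if p₁ T then Φ (X₀ T) (insert s ({j} : Set V)) else 0) :=
    Finset.sum_le_sum fun T _ => hdiag T
  show 0 ≤ ∑ T : Set (Sym2 V), (if tops T then ΦG T else 0)
  rw [h1]
  linarith [hrr, hblock, h2, hswap]

/-- **THEOREM TP (the |R| = 1 vertex antithetic inequality at a twin over a non-edge `{a, j}`, `N(j) = {s, P, j₀}`).**  For all monotone
`F, G`: `0 ≤ Σ_{T : ¬(P ∈ X T ∧ P ∈ Y T)} (F(X T) − F(Y T))·(G(X T) − G(Y T))` — the rest of the graph arbitrary. [this work] -/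
theorem vertex_sum_nonneg (E : Set (Sym2 V)) (s P a j j₀ : V)
    (hsP : s ≠ P) (hsa : s ≠ a) (hsj : s ≠ j) (hPa : P ≠ a) (hPj : P ≠ j) (haj : a ≠ j) (hj₀s : j₀ ≠ s) (hj₀P : j₀ ≠ P) (hj₀j : j₀ ≠ j)
    (hNs : ∀ v, s(s, v) ∈ E ↔ (v = a ∨ v = j)) (hNP : ∀ v, s(P, v) ∈ E ↔ (v = a ∨ v = j))
    (hNj : ∀ v, s(j, v) ∈ E ↔ (v = s ∨ v = P ∨ v = j₀))
    {F G : Set V → ℝ} (hF : Monotone F) (hG : Monotone G) :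
    0 ≤ ∑ T ∈ Finset.univ.filter (fun T : Set (Sym2 V) =>
        ¬ ((openGraph (T ∩ E)).Reachable s P ∧ (openGraph (Tᶜ ∩ E)).Reachable s P)),
      (F (openCluster (T ∩ E) s) - F (openCluster (Tᶜ ∩ E) s)) * (G (openCluster (T ∩ E) s) - G (openCluster (Tᶜ ∩ E) s)) :=
  TopVertex.vertex_sum_nonneg_of_top E s P (fun F' G' hF' hG' =>
    top_shift_sum_nonneg E s P a j j₀ hsP hsa hsj hPa hPj haj hj₀s hj₀P hj₀j hNs hNP hNj F' F' G' G' hF' hF' (fun _ => le_rfl)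
      hG' hG' (fun _ => le_rfl)) hF hG

end TwinPair

end Antithetic

end Summit.CriticalPhenomena.PercolationContinuityZ3.Theorems
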